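import Literature.Analysis.FluidPDE.PeriodicLerayProfileRegularity
import Literature.Analysis.FluidPDE.PeriodicLerayProfileLq
import Literature.Analysis.FluidPDE.PeriodicLerayProfileFarField
import HarnessLib

/-!
# [BT1] Lemma 2.5, discharge II: `L^q` bounds for `ξ_R U₀` and `w`, the time derivative of
# `w`, and the decay of `∇w`

Analysis/FluidPDE proof file (theorems only), second part of the discharge of the named fact
`Literature.Analysis.FluidPDE.bradshawTsai2017_lemma_2_5` (`PeriodicLerayExistence.lean`;
Bradshaw–Tsai, Ann. Henri Poincaré 18 (2017) = arXiv:1510.07504 [BT1], Lemma 2.5), for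
`W = revisedProfile R U₀ = ξ_R U₀ + w`, `w = profileCorrector R U₀ = −G_R ⋆ ∇Γ`,
`G_R(s,z) = ∇ξ_R(z)·U₀(s,z)`:

* `eLpNorm_cutoffScaled_smul_le`: `‖ξ_R U₀(s)‖_{L^p} ≤ ‖U₀(s)‖_{L^p(|y| ≥ R)}` (`ξ_R = 0` on `B_R`,
  `0 ≤ ξ_R ≤ 1`);
* `exists_eLpNorm_profileCorrector_le`: **"`‖w‖_{L^q} ≤ c_q ‖ξU₀‖_{L^q}`"** in the form
  `‖w(s)‖_{L^q} ≤ K_q ‖U₀(s)‖_{L^q(|y| ≥ R)}`, `K_q` independent of `R` and `s`, for every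
  `2 ≤ q ≤ ∞` (from `NewtonGradPotential.exists_eLpNorm_potential_le`, Young's inequality in
  place of the Calderón–Zygmund theorem of the printed proof);
* the time derivative: `∂ₛw(s) = −(∂ₛG_R(s,·)) ⋆ ∇Γ` with `∂ₛG_R = ∇ξ_R·∂ₛU₀`
  (`hasDerivAt_profileCorrector_time`, `timeDeriv_profileCorrector`), and
  **"`‖∂ₛw‖_{L²} ≤ c‖∇ξ·∂ₛU₀‖`"** (`exists_eLpNorm_timeDeriv_profileCorrector_le`, again by Young
  instead of Hardy–Littlewood–Sobolev);
* the time derivative of `W`: `∂ₛW = ξ_R ∂ₛU₀ + ∂ₛw` (`timeDeriv_revisedProfile`);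
* **"`|∇w(y)| ≤ C/(1+|y|³)`"** in the two forms used: `‖Dw(s)(y)‖ ≤ A(1+|y|)⁻²` everywhere
  (`PeriodicLerayProfileGradient.norm_fderiv_profileCorrector_le`) and
  `‖Dw(s)(y) y‖ ≤ K(1+|y|)⁻²` everywhere (`norm_fderiv_profileCorrector_apply_self_le`, the far
  field from `NewtonGradPotential.norm_fderiv_potential_apply_le_of_far`).

## References

* Z. Bradshaw, T.-P. Tsai, Ann. Henri Poincaré 18 (2017) = arXiv:1510.07504, Lemma 2.5 and its
  proof [BradshawTsai2017AHP].
-/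

noncomputable section

open MeasureTheory Set Function Filter Topology TopologicalSpace Metric InnerProductSpace
open scoped NNReal ENNReal RealInnerProductSpace Convolution

namespace Literature.Analysis.FluidPDE

namespace BradshawTsai2017

open NewtonGradPotential

variable {U₀ : ℝ → EuclideanSpace ℝ (Fin 3) → EuclideanSpace ℝ (Fin 3)} {R : ℝ}

/-! ### `L^p` norms of the cut-off part and of indicator fields -/

/-- **`‖ξ_R U₀(s)‖_{L^p} ≤ ‖U₀(s)‖_{L^p(|y| ≥ R)}`** (`ξ_R U₀(s)` vanishes on the open ball `B_R`
and `|ξ_R| ≤ 1`). [cite: BradshawTsai2017AHP, proof of Lemma 2.5] -/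
theorem eLpNorm_cutoffScaled_smul_le (hR : 0 < R) (u : EuclideanSpace ℝ (Fin 3) →
    EuclideanSpace ℝ (Fin 3)) (p : ℝ≥0∞) :
    eLpNorm (fun y => cutoffScaled R y • u y) p volume ≤
      eLpNorm u p (volume.restrict (ball (0 : EuclideanSpace ℝ (Fin 3)) R)ᶜ) := by
  have e : (fun y => cutoffScaled R y • u y) =
      (ball (0 : EuclideanSpace ℝ (Fin 3)) R)ᶜ.indicator fun y => cutoffScaled R y • u y := by
    funext y
    by_cases hy : y ∈ (ball (0 : EuclideanSpace ℝ (Fin 3)) R)ᶜ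
    · rw [indicator_of_mem hy]
    · rw [indicator_of_notMem hy]
      rw [mem_compl_iff, not_not, mem_ball_zero_iff] at hy
      rw [cutoffScaled_eq_zero hR hy.le, zero_smul]
  rw [e, eLpNorm_indicator_eq_eLpNorm_restrict measurableSet_ball.compl]
  refine eLpNorm_mono fun y => ?_
  rw [norm_smul, Real.norm_eq_abs]
  have h := cutoffZ_mem_Icc (R⁻¹ • y)
  have h1 : |cutoffScaled R y| ≤ 1 := by
    rw [abs_le]
    exact ⟨by linarith [h.1, show cutoffScaled R y = cutoffZ (R⁻¹ • y) from rfl],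
      by rw [show cutoffScaled R y = cutoffZ (R⁻¹ • y) from rfl]; exact h.2⟩
  calc |cutoffScaled R y| * ‖u y‖ ≤ 1 * ‖u y‖ := by gcongr
    _ = ‖u y‖ := one_mul _

/-- The shell `{R < |z| < 2R}` is measurable. [folklore] -/
theorem measurableSet_shell (R : ℝ) :
    MeasurableSet {z : EuclideanSpace ℝ (Fin 3) | R < ‖z‖ ∧ ‖z‖ < 2 * R} :=
  (isOpen_lt continuous_const continuous_norm).measurableSet.inter
    (isOpen_lt continuous_norm continuous_const).measurableSet

/-- The `L^p` norm of `C • 1_{shell} u` is at most `|C| ‖u‖_{L^p(|z| ≥ R)}`. [folklore] -/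
theorem eLpNorm_const_smul_indicator_shell_le (C R : ℝ) {E' : Type*} [NormedAddCommGroup E']
    [NormedSpace ℝ E'] (u : EuclideanSpace ℝ (Fin 3) → E') (p : ℝ≥0∞) :
    eLpNorm (C • {z : EuclideanSpace ℝ (Fin 3) | R < ‖z‖ ∧ ‖z‖ < 2 * R}.indicator u) p volume ≤
      ENNReal.ofReal |C| * eLpNorm u p (volume.restrict (ball (0 : EuclideanSpace ℝ (Fin 3)) R)ᶜ) := by
  rw [eLpNorm_const_smul, Real.enorm_eq_ofReal_abs,
    eLpNorm_indicator_eq_eLpNorm_restrict (measurableSet_shell R)]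
  refine mul_le_mul' le_rfl (eLpNorm_mono_measure _ (Measure.restrict_mono ?_ le_rfl))
  intro z hz
  rw [mem_compl_iff, mem_ball_zero_iff, not_lt]
  exact hz.1.le

/-- An indicator field bounded by `M` on the shell has `‖1_{shell} u‖_{L^p} ≤ |B_{2R}|^{1/p} M`. [folklore] -/
theorem eLpNorm_indicator_shell_le_of_bound {E' : Type*} [NormedAddCommGroup E'] {R M : ℝ}
    {u : EuclideanSpace ℝ (Fin 3) → E'} (hM : ∀ z, ‖z‖ ≤ 2 * R → ‖u z‖ ≤ M) (p : ℝ≥0∞) :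
    eLpNorm ({z : EuclideanSpace ℝ (Fin 3) | R < ‖z‖ ∧ ‖z‖ < 2 * R}.indicator u) p volume ≤
      (volume (ball (0 : EuclideanSpace ℝ (Fin 3)) (2 * R))) ^ (1 / p.toReal) *
        ENNReal.ofReal M := by
  rw [eLpNorm_indicator_eq_eLpNorm_restrict (measurableSet_shell R)]
  have h := eLpNorm_le_of_ae_bound (μ := volume.restrict
    {z : EuclideanSpace ℝ (Fin 3) | R < ‖z‖ ∧ ‖z‖ < 2 * R}) (f := u) (p := p) (C := M)
    ((ae_restrict_iff' (measurableSet_shell R)).2 (Eventually.of_forall fun z hz =>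
      hM z hz.2.le))
  refine h.trans ?_
  rw [Measure.restrict_apply_univ, one_div]
  gcongr
  exact fun z hz => mem_ball_zero_iff.2 hz.2

/-! ### The `L^q` bound for the corrector, uniform in the scale -/

/-- The corrector as a potential of the negated density: `w(s)(y) = ∫ (−G_R(s,z)) ∇Γ(y − z) dz`. [cite: BradshawTsai2017AHP, Lemma 2.5 (definition of w)] -/
theorem profileCorrector_eq_integral_neg (R : ℝ)
    (U₀ : ℝ → EuclideanSpace ℝ (Fin 3) → EuclideanSpace ℝ (Fin 3)) (s : ℝ)
    (y : EuclideanSpace ℝ (Fin 3)) :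
    profileCorrector R U₀ s y =
      ∫ z, (-⟪gradient (cutoffScaled R) z, U₀ s z⟫) • gradient newtonKernel (y - z) := by
  rw [profileCorrector, ← integral_neg]
  refine integral_congr_ae (Eventually.of_forall fun z => ?_)
  simp only [neg_smul]

/-- **"`‖w‖_{L^q(ℝ³)} ≤ c_q‖ξU₀‖_{L^q(ℝ³)}`" with a constant independent of the scale**: for
every `2 ≤ q ≤ ∞` there is `K_q` such that for all continuous-sliced `U₀`, all `R > 0` and
all `s`, `‖profileCorrector R U₀ s‖_{L^q} ≤ K_q ‖U₀(s)‖_{L^q(|y| ≥ R)}` (the density is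
dominated by `(C_Z/R) 1_{R<|z|<2R} |U₀(s)|`, and `NewtonGradPotential.exists_eLpNorm_potential_le`
applies). [cite: BradshawTsai2017AHP, proof of Lemma 2.5] -/
theorem exists_eLpNorm_profileCorrector_le {q : ℝ≥0∞} (hq : 2 ≤ q) :
    ∃ K : ℝ≥0, ∀ ⦃U₀ : ℝ → EuclideanSpace ℝ (Fin 3) → EuclideanSpace ℝ (Fin 3)⦄,
      (∀ s, Continuous (U₀ s)) → ∀ ⦃R : ℝ⦄, 0 < R → ∀ s,
        eLpNorm (profileCorrector R U₀ s) q volume ≤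
          K * eLpNorm ({z : EuclideanSpace ℝ (Fin 3) | R < ‖z‖ ∧ ‖z‖ < 2 * R}.indicator (U₀ s))
            q volume := by
  obtain ⟨C_Z, hC_Z0, hC_Z⟩ := exists_norm_gradient_cutoffScaled_le
  obtain ⟨C, hC⟩ := exists_eLpNorm_potential_le (EuclideanSpace ℝ (Fin 3)) hq
  refine ⟨C * NNReal.mk C_Z hC_Z0, fun U₀ hU R hR s => ?_⟩
  set S : Set (EuclideanSpace ℝ (Fin 3)) := {z | R < ‖z‖ ∧ ‖z‖ < 2 * R} with hS
  set u : EuclideanSpace ℝ (Fin 3) → EuclideanSpace ℝ (Fin 3) := C_Z • S.indicator (U₀ s) with hu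
  have hum : AEStronglyMeasurable u volume :=
    (((hU s).aestronglyMeasurable).indicator (measurableSet_shell R)).const_smul C_Z
  have hφu : ∀ z, |(-⟪gradient (cutoffScaled R) z, U₀ s z⟫)| ≤ R⁻¹ * ‖u z‖ := fun z => by
    rw [abs_neg]
    exact abs_density_le hC_Z hR s z
  have hu0 : ∀ z, 2 * R ≤ ‖z‖ → u z = 0 := fun z hz => by
    have : z ∉ S := fun h => not_lt.2 hz h.2
    rw [hu, Pi.smul_apply, indicator_of_notMem this, smul_zero]
  have e : profileCorrector R U₀ s = fun y =>
      ∫ z, (-⟪gradient (cutoffScaled R) z, U₀ s z⟫) • gradient newtonKernel (y - z) :=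
    funext (profileCorrector_eq_integral_neg R U₀ s)
  rw [e]
  refine (hC hR hum hφu hu0).trans (le_of_eq ?_)
  rw [ENNReal.coe_mul, mul_assoc, hu, eLpNorm_const_smul, Real.enorm_eq_ofReal hC_Z0,
    ENNReal.ofReal_eq_coe_nnreal hC_Z0]

/-- `L^q(|y| ≥ R)` form of `exists_eLpNorm_profileCorrector_le`:
`‖w(s)‖_{L^q} ≤ K_q ‖U₀(s)‖_{L^q(|y| ≥ R)}` — the form combined with the decay modulus `Θ(R)`
of Assumption 2.1 ("`‖w‖_{L^q} ≤ c_q‖ξU₀‖_{L^q} ≤ c_qΘ(R₀)`"). [cite: BradshawTsai2017AHP, proof of Lemma 2.5] -/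
theorem exists_eLpNorm_profileCorrector_le_restrict {q : ℝ≥0∞} (hq : 2 ≤ q) :
    ∃ K : ℝ≥0, ∀ ⦃U₀ : ℝ → EuclideanSpace ℝ (Fin 3) → EuclideanSpace ℝ (Fin 3)⦄,
      (∀ s, Continuous (U₀ s)) → ∀ ⦃R : ℝ⦄, 0 < R → ∀ s,
        eLpNorm (profileCorrector R U₀ s) q volume ≤
          K * eLpNorm (U₀ s) q (volume.restrict (ball (0 : EuclideanSpace ℝ (Fin 3)) R)ᶜ) := by
  obtain ⟨K, hK⟩ := exists_eLpNorm_profileCorrector_le hq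
  refine ⟨K, fun U₀ hU R hR s => (hK hU hR s).trans (mul_le_mul' le_rfl ?_)⟩
  have h := eLpNorm_const_smul_indicator_shell_le 1 R (U₀ s) q
  rw [one_smul, abs_one, ENNReal.ofReal_one, one_mul] at h
  exact h

/-! ### Time derivatives: `∂ₛU₀`, `∂ₛG_R = ∇ξ_R · ∂ₛU₀`, `∂ₛw = −∂ₛG_R ⋆ ∇Γ`, `∂ₛW` -/

/-- The time slice `s ↦ U₀(s, y)` of a jointly `C¹` field has derivative `DU₀(s,y)(1,0)`. [folklore] -/
theorem hasDerivAt_profileSlice_time (hU : ContDiff ℝ 1 (uncurry U₀)) (s : ℝ)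
    (y : EuclideanSpace ℝ (Fin 3)) :
    HasDerivAt (fun s' => U₀ s' y) (fderiv ℝ (uncurry U₀) (s, y) (1, 0)) s := by
  have h := ((hU.differentiable one_ne_zero (s, y)).hasFDerivAt).comp_hasDerivAt s
    ((hasDerivAt_id s).prodMk (hasDerivAt_const s y))
  exact h

/-- `timeDeriv U₀ s y = DU₀(s,y)(1,0)` for a jointly `C¹` field. [folklore] -/
theorem timeDeriv_profile (hU : ContDiff ℝ 1 (uncurry U₀)) (s : ℝ) (y : EuclideanSpace ℝ (Fin 3)) :
    timeDeriv U₀ s y = fderiv ℝ (uncurry U₀) (s, y) (1, 0) :=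
  (hasDerivAt_profileSlice_time hU s y).deriv

/-- **`∂ₛG_R = ∇ξ_R · ∂ₛU₀`**: the time derivative of the density `G_R(s,z) = ∇ξ_R(z)·U₀(s,z)`. [cite: BradshawTsai2017AHP, proof of Lemma 2.5] -/
theorem fderiv_uncurry_density_apply (hU : ContDiff ℝ 1 (uncurry U₀)) (R s : ℝ)
    (z : EuclideanSpace ℝ (Fin 3)) :
    fderiv ℝ (uncurry fun s z => ⟪gradient (cutoffScaled R) z, U₀ s z⟫) (s, z) (1, 0) =
      ⟪gradient (cutoffScaled R) z, fderiv ℝ (uncurry U₀) (s, z) (1, 0)⟫ := by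
  have hg : HasFDerivAt (gradient (cutoffScaled R) ∘ (Prod.snd : ℝ × EuclideanSpace ℝ (Fin 3) →
      EuclideanSpace ℝ (Fin 3)))
      ((fderiv ℝ (gradient (cutoffScaled R)) z).comp
        (ContinuousLinearMap.snd ℝ ℝ (EuclideanSpace ℝ (Fin 3)))) (s, z) :=
    HasFDerivAt.comp (s, z)
      (((contDiff_gradient_cutoffScaled R).differentiable one_ne_zero z).hasFDerivAt)
      hasFDerivAt_snd
  have hu : HasFDerivAt (uncurry U₀) (fderiv ℝ (uncurry U₀) (s, z)) (s, z) :=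
    (hU.differentiable one_ne_zero (s, z)).hasFDerivAt
  have h := hg.inner ℝ hu
  have e : (uncurry fun s z => ⟪gradient (cutoffScaled R) z, U₀ s z⟫) =
      fun p : ℝ × EuclideanSpace ℝ (Fin 3) =>
        ⟪(gradient (cutoffScaled R) ∘ (Prod.snd : ℝ × EuclideanSpace ℝ (Fin 3) →
          EuclideanSpace ℝ (Fin 3))) p, uncurry U₀ p⟫ := by
    funext p; rfl
  rw [e, h.fderiv]
  simp [fderivInnerCLM_apply]

/-- **`∂ₛw(s) = −(∂ₛG_R(s,·)) ⋆ ∇Γ`**: the time derivative of the corrector is minus the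
potential of the density `∇ξ_R·∂ₛU₀(s)` ([BT1]: "`∂ₛw(y,s) = ∇_y∫ (4π|y−z|)⁻¹ ∇_zξ(z)·∂ₛU₀(z,s) dz`";
differentiation under the integral, `NewtonGradPotential.hasDerivAt_convolution_gradient_newtonKernel_param`). [cite: BradshawTsai2017AHP, proof of Lemma 2.5] -/
theorem hasDerivAt_profileCorrector_time (hU : ContDiff ℝ 1 (uncurry U₀)) (hR : 0 < R) (s : ℝ)
    (y : EuclideanSpace ℝ (Fin 3)) :
    HasDerivAt (fun s' => profileCorrector R U₀ s' y)
      (-∫ z, ⟪gradient (cutoffScaled R) z, fderiv ℝ (uncurry U₀) (s, z) (1, 0)⟫ •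
        gradient newtonKernel (y - z)) s := by
  have h := (hasDerivAt_convolution_gradient_newtonKernel_param (Φ := fun s z =>
    ⟪gradient (cutoffScaled R) z, U₀ s z⟫) (contDiff_cutoffGradDensity hU R) (ρ := 2 * R)
    (fun s z hz => cutoffGradDensity_eq_zero hR (U₀ s) hz) s y).neg
  have e1 : (fun s' => profileCorrector R U₀ s' y) = fun s' =>
      -((fun z => ⟪gradient (cutoffScaled R) z, U₀ s' z⟫) ⋆[ContinuousLinearMap.lsmul ℝ ℝ,
        volume] gradient newtonKernel) y :=
    funext fun s' => profileCorrector_eq_neg_convolution R U₀ s' y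
  rw [e1]
  refine h.congr_deriv ?_
  rw [convolution_gradient_newtonKernel_apply]
  congr 1
  refine integral_congr_ae (Eventually.of_forall fun z => ?_)
  simp only [fderiv_uncurry_density_apply hU R s]

/-- `∂ₛw(s)(y)` as the potential of the density `−∇ξ_R·∂ₛU₀(s)`. [cite: BradshawTsai2017AHP, proof of Lemma 2.5] -/
theorem timeDeriv_profileCorrector (hU : ContDiff ℝ 1 (uncurry U₀)) (hR : 0 < R) (s : ℝ)
    (y : EuclideanSpace ℝ (Fin 3)) :
    timeDeriv (profileCorrector R U₀) s y =
      ∫ z, (-⟪gradient (cutoffScaled R) z, fderiv ℝ (uncurry U₀) (s, z) (1, 0)⟫) •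
        gradient newtonKernel (y - z) := by
  rw [timeDeriv_apply, (hasDerivAt_profileCorrector_time hU hR s y).deriv, ← integral_neg]
  refine integral_congr_ae (Eventually.of_forall fun z => ?_)
  simp only [neg_smul]

/-- **"`‖∂ₛw‖_{L²(ℝ³)} ≤ c‖∇ξ·∂ₛU₀‖`"** with `L²` on the right (Young in place of
Hardy–Littlewood–Sobolev): there is `K` with
`‖∂ₛw(s)‖_{L²} ≤ K ‖1_{R<|z|<2R} ∂ₛU₀(s)‖_{L²(|z| ≥ R)}` for all `U₀ ∈ C¹`, `R > 0`, `s`. [cite: BradshawTsai2017AHP, proof of Lemma 2.5] -/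
theorem exists_eLpNorm_timeDeriv_profileCorrector_le :
    ∃ K : ℝ≥0, ∀ ⦃U₀ : ℝ → EuclideanSpace ℝ (Fin 3) → EuclideanSpace ℝ (Fin 3)⦄,
      ContDiff ℝ 1 (uncurry U₀) → ∀ ⦃R : ℝ⦄, 0 < R → ∀ s,
        eLpNorm (timeDeriv (profileCorrector R U₀) s) 2 volume ≤
          K * eLpNorm ({z : EuclideanSpace ℝ (Fin 3) | R < ‖z‖ ∧ ‖z‖ < 2 * R}.indicator
            fun z => fderiv ℝ (uncurry U₀) (s, z) (1, 0)) 2 volume := by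
  obtain ⟨C_Z, hC_Z0, hC_Z⟩ := exists_norm_gradient_cutoffScaled_le
  obtain ⟨C, hC⟩ := exists_eLpNorm_potential_le (EuclideanSpace ℝ (Fin 3)) (q := 2) le_rfl
  refine ⟨C * NNReal.mk C_Z hC_Z0, fun U₀ hU R hR s => ?_⟩
  set V : ℝ → EuclideanSpace ℝ (Fin 3) → EuclideanSpace ℝ (Fin 3) := fun s z =>
    fderiv ℝ (uncurry U₀) (s, z) (1, 0) with hV
  have hVc : Continuous (V s) :=
    ((hU.continuous_fderiv one_ne_zero).clm_apply continuous_const).comp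
      (continuous_const.prodMk continuous_id)
  set S : Set (EuclideanSpace ℝ (Fin 3)) := {z | R < ‖z‖ ∧ ‖z‖ < 2 * R} with hS
  set u : EuclideanSpace ℝ (Fin 3) → EuclideanSpace ℝ (Fin 3) := C_Z • S.indicator (V s) with hu
  have hum : AEStronglyMeasurable u volume :=
    ((hVc.aestronglyMeasurable).indicator (measurableSet_shell R)).const_smul C_Z
  have hφu : ∀ z, |(-⟪gradient (cutoffScaled R) z, fderiv ℝ (uncurry U₀) (s, z) (1, 0)⟫)| ≤
      R⁻¹ * ‖u z‖ := fun z => by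
    rw [abs_neg]
    exact abs_density_le (U₀ := V) hC_Z hR s z
  have hu0 : ∀ z, 2 * R ≤ ‖z‖ → u z = 0 := fun z hz => by
    have : z ∉ S := fun h => not_lt.2 hz h.2
    rw [hu, Pi.smul_apply, indicator_of_notMem this, smul_zero]
  have e : timeDeriv (profileCorrector R U₀) s = fun y =>
      ∫ z, (-⟪gradient (cutoffScaled R) z, fderiv ℝ (uncurry U₀) (s, z) (1, 0)⟫) •
        gradient newtonKernel (y - z) :=
    funext (timeDeriv_profileCorrector hU hR s)
  rw [e]
  refine (hC hR hum hφu hu0).trans (le_of_eq ?_)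
  rw [ENNReal.coe_mul, mul_assoc, hu, eLpNorm_const_smul, Real.enorm_eq_ofReal hC_Z0,
    ENNReal.ofReal_eq_coe_nnreal hC_Z0]

/-- **`∂ₛW = ξ_R ∂ₛU₀ + ∂ₛw`** pointwise. [cite: BradshawTsai2017AHP, proof of Lemma 2.5] -/
theorem timeDeriv_revisedProfile (hU : ContDiff ℝ 1 (uncurry U₀)) (hR : 0 < R) (s : ℝ)
    (y : EuclideanSpace ℝ (Fin 3)) :
    timeDeriv (revisedProfile R U₀) s y =
      cutoffScaled R y • fderiv ℝ (uncurry U₀) (s, y) (1, 0) +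
        timeDeriv (profileCorrector R U₀) s y := by
  have h1 : HasDerivAt (fun s' => cutoffScaled R y • U₀ s' y)
      (cutoffScaled R y • fderiv ℝ (uncurry U₀) (s, y) (1, 0)) s :=
    (hasDerivAt_profileSlice_time hU s y).const_smul (cutoffScaled R y)
  have h2 := hasDerivAt_profileCorrector_time hU hR s y
  rw [timeDeriv_apply, timeDeriv_apply, h2.deriv]
  exact (h1.add h2).deriv

/-! ### The decay of `∇w`: `‖Dw(s)(y) y‖ ≤ K (1 + |y|)⁻²` -/

/-- **`‖Dw(s)(y) v‖ ≤ 8‖v‖ (∫|G_R(s)|)/(π|y|³)` for `|y| ≥ 4R`** (kernel-side differentiation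
off the support, `NewtonGradPotential.norm_fderiv_potential_apply_le_of_far`; [BT1]: "If
`|y| ≥ 4R₀` then … `|∇w(y)| ≤ cR₀^{5/4}‖U₀‖_{L⁴}/|y|³`"). [cite: BradshawTsai2017AHP, proof of Lemma 2.5] -/
theorem norm_fderiv_profileCorrector_apply_le_of_far (hU : ∀ s, Continuous (U₀ s)) (hR : 0 < R)
    (s : ℝ) {y : EuclideanSpace ℝ (Fin 3)} (hy : 4 * R ≤ ‖y‖) (v : EuclideanSpace ℝ (Fin 3)) :
    ‖fderiv ℝ (profileCorrector R U₀ s) y v‖ ≤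
      8 / (Real.pi * ‖y‖ ^ 3) * (∫ z, |⟪gradient (cutoffScaled R) z, U₀ s z⟫|) * ‖v‖ := by
  have e : profileCorrector R U₀ s = fun y =>
      ∫ z, (-⟪gradient (cutoffScaled R) z, U₀ s z⟫) • gradient newtonKernel (y - z) :=
    funext (profileCorrector_eq_integral_neg R U₀ s)
  have hG : Continuous fun z => -⟪gradient (cutoffScaled R) z, U₀ s z⟫ :=
    ((contDiff_gradient_cutoffScaled R).continuous.inner (hU s)).neg
  have h := norm_fderiv_potential_apply_le_of_far hG (by positivity : 0 < 2 * R)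
    (fun z hz => by rw [cutoffGradDensity_eq_zero hR (U₀ s) hz, neg_zero])
    (y := y) (by linarith) v
  rw [e]
  refine h.trans (le_of_eq ?_)
  simp only [abs_neg]

/-- **The weighted decay `‖Dw(s)(y) y‖ ≤ K (1 + |y|)⁻²` everywhere**, given the two uniform
inputs `‖DG_R(s,·)‖ ≤ M` (so `‖Dw(s)(y)‖ ≤ A(M,R)(1+|y|)⁻²` for all `y`,
`norm_fderiv_profileCorrector_le`) and `∫|G_R(s)| ≤ I` (so `‖Dw(s)(y) y‖ ≤ 8I/(π|y|²)` for
`|y| ≥ 4R`): near the origin `‖Dw(s)(y) y‖ ≤ 4R·A(1+|y|)⁻²`, far away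
`8I/(π|y|²) ≤ (8I/π)(1 + (4R)⁻¹)²(1+|y|)⁻²`. [cite: BradshawTsai2017AHP, proof of Lemma 2.5] -/
theorem norm_fderiv_profileCorrector_apply_self_le (hU : ContDiff ℝ 1 (uncurry U₀)) (hR : 0 < R)
    {s : ℝ} {M I : ℝ}
    (hM : ∀ z, ‖fderiv ℝ (fun z => ⟪gradient (cutoffScaled R) z, U₀ s z⟫) z‖ ≤ M)
    (hI : ∫ z, |⟪gradient (cutoffScaled R) z, U₀ s z⟫| ≤ I) (y : EuclideanSpace ℝ (Fin 3)) :
    ‖fderiv ℝ (profileCorrector R U₀ s) y y‖ ≤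
      (4 * R * max (5 * M * (2 * R) * (1 + 2 * (2 * R)) ^ 2)
          (4 / 3 * M * (2 * R) ^ 3 * (1 + (2 * (2 * R))⁻¹) ^ 2) +
        8 * I / Real.pi * (1 + (4 * R)⁻¹) ^ 2) * ((1 + ‖y‖) ^ 2)⁻¹ := by
  set A : ℝ := max (5 * M * (2 * R) * (1 + 2 * (2 * R)) ^ 2)
    (4 / 3 * M * (2 * R) ^ 3 * (1 + (2 * (2 * R))⁻¹) ^ 2) with hA
  have hM0 : 0 ≤ M := (norm_nonneg _).trans (hM 0)
  have hA0 : 0 ≤ A := le_max_of_le_left (by positivity)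
  have hI0 : 0 ≤ I := (integral_nonneg fun z => abs_nonneg _).trans hI
  have hglob := norm_fderiv_profileCorrector_le hU hR hM y
  rw [← hA] at hglob
  rcases le_or_gt (4 * R) ‖y‖ with hfar | hnear
  · -- far field
    have hy0 : 0 < ‖y‖ := by linarith
    have h1 := norm_fderiv_profileCorrector_apply_le_of_far (U₀ := U₀)
      (fun s => (contDiff_profileSlice hU s).continuous) hR s hfar y
    have h2 : 8 / (Real.pi * ‖y‖ ^ 3) * (∫ z, |⟪gradient (cutoffScaled R) z, U₀ s z⟫|) * ‖y‖ ≤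
        8 * I / Real.pi * (‖y‖ ^ 2)⁻¹ := by
      calc 8 / (Real.pi * ‖y‖ ^ 3) * (∫ z, |⟪gradient (cutoffScaled R) z, U₀ s z⟫|) * ‖y‖
          ≤ 8 / (Real.pi * ‖y‖ ^ 3) * I * ‖y‖ := by gcongr
        _ = 8 * I / Real.pi * (‖y‖ ^ 2)⁻¹ := by field_simp
    have hratio : (1 + ‖y‖) * ‖y‖⁻¹ ≤ 1 + (4 * R)⁻¹ := by
      rw [add_mul, mul_inv_cancel₀ hy0.ne', one_mul, add_comm]
      gcongr
    have key : (‖y‖ ^ 2)⁻¹ ≤ (1 + (4 * R)⁻¹) ^ 2 * ((1 + ‖y‖) ^ 2)⁻¹ := by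
      have h2 : (‖y‖ ^ 2)⁻¹ = ((1 + ‖y‖) * ‖y‖⁻¹) ^ 2 * ((1 + ‖y‖) ^ 2)⁻¹ := by
        field_simp
      rw [h2]
      exact mul_le_mul_of_nonneg_right (pow_le_pow_left₀ (by positivity) hratio 2)
        (by positivity)
    calc ‖fderiv ℝ (profileCorrector R U₀ s) y y‖ ≤ 8 * I / Real.pi * (‖y‖ ^ 2)⁻¹ := h1.trans h2
      _ ≤ 8 * I / Real.pi * ((1 + (4 * R)⁻¹) ^ 2 * ((1 + ‖y‖) ^ 2)⁻¹) :=
          mul_le_mul_of_nonneg_left key (by positivity)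
      _ = (0 + 8 * I / Real.pi * (1 + (4 * R)⁻¹) ^ 2) * ((1 + ‖y‖) ^ 2)⁻¹ := by ring
      _ ≤ _ := by gcongr; positivity
  · -- near field
    calc ‖fderiv ℝ (profileCorrector R U₀ s) y y‖
        ≤ ‖fderiv ℝ (profileCorrector R U₀ s) y‖ * ‖y‖ := ContinuousLinearMap.le_opNorm _ _
      _ ≤ A * ((1 + ‖y‖) ^ 2)⁻¹ * (4 * R) :=
          mul_le_mul hglob hnear.le (norm_nonneg _) (by positivity)
      _ = (4 * R * A + 0) * ((1 + ‖y‖) ^ 2)⁻¹ := by ring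
      _ ≤ _ := by gcongr; positivity

end BradshawTsai2017

end Literature.Analysis.FluidPDE

end
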